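import Literature.AlgebraicGeometry.Motives.AbelianVarietyRationalFunctionFieldPoints
import Literature.AlgebraicGeometry.Morphisms.SeparatedRigidityDedekind
import Mathlib.Algebra.MvPolynomial.Funext
import HarnessLib

/-!
# `A(k(x₁, …, xₙ)) = A(k)`: an abelian variety acquires no new points in a purely transcendental
# extension (Milne, *Abelian Varieties*, §3 Thm. 3.1, Cor. 3.8 — several variables)

J. S. Milne, *Abelian Varieties* (Ch. V of Cornell–Silverman, *Arithmetic Geometry*, 1986), §3,
Cor. 3.8 ("Every rational map `ℙ¹ ⇢ A` is constant"; more generally "every rational map `V ⇢ A`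
from a unirational variety is constant", loc. cit. after Cor. 3.8) with Thm. 3.1 (a rational map from
a smooth variety to an abelian variety is a morphism).  The tree proves the ONE-variable point form
`A(k(y)) = A(k)` (`AbelianVariety.algPoints_const_of_isFractionRing`,
`Motives/AbelianVarietyRationalFunctionFieldPoints`) from `AbelianVariety.specMap_affineLine_const`
(every `k`-morphism `𝔸¹_k → A` is constant).  This PROOF-ONLY file does `n` variables, for an
INFINITE ground field `k`:

* `dense_range_rationalPoint_mvPolynomial` — the `k`-rational points `u ∈ kⁿ` (indeed `u ∈ k^σ` for
  any index type `σ`) are Zariski dense in `𝔸^σ_k = Spec k[x_σ]` (`k` infinite: a polynomial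
  vanishing on `k^σ` is zero, Mathlib `MvPolynomial.funext`);
* `AbelianVariety.specMap_affineSpace_const` — **every `k`-morphism `𝔸^σ_k → A` to an abelian
  variety is constant** (factors through a `k`-point of `A`): restricted to the line through `0` and
  a rational point `u` it is a morphism `𝔸¹_k → A`, constant by Cor. 3.8, so it takes the same value
  at `u` and at `0`; rational points being dense and `A` separated, the morphism equals the constant
  one (the tree's `ext_of_dense_of_forall_exists_comp_eq`, Hartshorne II Ex. 4.2) — ANY index type `σ`;
* `AbelianVariety.fromSpecStalk_genericPoint_affineSpace_const` — a `k`-morphism from the generic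
  point `Spec k(x₁,…,xₙ) → A` of `𝔸ⁿ_k` factors through a `k`-point of `A` (spread out to an open
  `U ∋ ξ`, Mathlib `spread_out_of_isGermInjective'`; extend to `𝔸ⁿ`, Thm. 3.1 = the tree's
  `AbelianVariety.exists_extension_specMap`; constancy above);
* `AbelianVariety.algPoints_const_of_isFractionRing_mvPolynomial`, `…_of_algEquiv_mvPolynomial` —
  **`A(K) = A(k)` for every field `K` which is a field of fractions of `k[x₁, …, xₙ]` over `k`**
  (resp. `k`-isomorphic to `Frac k[x₁, …, xₙ]`): every `x : AlgPoints A.X K` is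
  `Spec (k → K) ≫ P₀` for a `k`-point `P₀`.

Everything is proved; no definitions, no named facts.
-- TODO(general form): finite ground fields (replace the density of rational points by the scaling
-- argument of `AbelianVarietyRationalCurvesProofs`), and an arbitrary (infinite) set of variables in
-- the generic-point statements (finite presentation of `A`).

This is junction K-n of the abc-iut cell's plan for [AbsTopIII] Rmk. 1.5.4 (iii) (Kummer-faithfulness
of `ℚ_p(x_i)_{i ∈ I}`, abelian-variety clause: "any finitely generated extension of `k` is contained
in a finitely generated extension of some `ℚ_p(x_i)_{i ∈ J}` … over which `k` is purely
transcendental").  HONEST FRAMING: classical algebraic geometry; nothing here bears on [IUTchIII].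

## References

* J. S. Milne, *Abelian Varieties*, in G. Cornell, J. H. Silverman (eds.), *Arithmetic Geometry*,
  Springer 1986, Ch. V, §3 Thm. 3.1, Cor. 3.8 (pp. 107–108). [Milne1986AbelianVarieties]
* R. Hartshorne, *Algebraic Geometry* (1977), II Ex. 4.2 (morphisms to a separated scheme agreeing
  on a dense set), II Ex. 2.7 (`K`-valued points). [Hartshorne1977]
* S. Lang, *Algebra* (3rd ed., 2002), Ch. IV §1 (a polynomial over an infinite field vanishing at every
  point is zero; Mathlib `MvPolynomial.funext`). [Lang2002]
* The Stacks Project, Tag 0BX6 (spreading out a morphism from a local ring). [StacksProject]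
-/

noncomputable section

universe u

open CategoryTheory AlgebraicGeometry MvPolynomial

namespace Literature.AlgebraicGeometry.Motives

open AbelianVarietyRationalCurves
open Literature.AlgebraicGeometry.Morphisms

variable {k : Type u} [Field k]

/-! ## Rational points of affine space are dense (infinite ground field) -/

/-- The point of `𝔸^σ_k = Spec k[x_σ]` underlying the rational point `u ∈ k^σ`: the kernel of the
evaluation `k[x_σ] → k`, `x_i ↦ u_i` (a maximal ideal). [cite: Hartshorne1977, II Ex. 2.7] -/
theorem isPrime_ker_eval (σ : Type) (u : σ → k) : (RingHom.ker (MvPolynomial.eval u)).IsPrime :=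
  RingHom.ker_isPrime _

/-- The `k`-point `Spec k → 𝔸^σ_k`, `x ↦ u`, passes through the point `ker (eval u)`.
[cite: Hartshorne1977, II Ex. 2.7] -/
theorem mem_range_specMap_aeval (σ : Type) (u : σ → k) :
    (⟨RingHom.ker (MvPolynomial.eval u), isPrime_ker_eval σ u⟩ :
        (Spec (CommRingCat.of (MvPolynomial σ k)) : Scheme.{u})) ∈
      Set.range (Spec.map (CommRingCat.ofHom (MvPolynomial.aeval u : MvPolynomial σ k →ₐ[k] k).toRingHom)) := by
  refine ⟨(⟨⊥, Ideal.isPrime_bot⟩ : PrimeSpectrum k), ?_⟩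
  rw [Spec.map_apply]
  apply PrimeSpectrum.ext
  change Ideal.comap (MvPolynomial.aeval u : MvPolynomial σ k →ₐ[k] k).toRingHom ⊥ = _
  rw [← RingHom.ker_eq_comap_bot]
  rfl

/-- **Rational points are Zariski dense in affine space over an infinite field**: the set of points
`ker (eval u)`, `u ∈ k^σ`, is dense in `Spec k[x_σ]` — a polynomial vanishing at every `u ∈ k^σ` is
zero (Mathlib `MvPolynomial.funext`), so the vanishing ideal of this set is `⊥`.
[cite: Lang2002, Ch. IV §1 (polynomial functions over an infinite field)] -/
theorem dense_range_rationalPoint_mvPolynomial [Infinite k] (σ : Type) :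
    Dense (Set.range fun u : σ → k =>
      (⟨RingHom.ker (MvPolynomial.eval u), isPrime_ker_eval σ u⟩ :
        (Spec (CommRingCat.of (MvPolynomial σ k)) : Scheme.{u}))) := by
  set T := Set.range fun u : σ → k =>
      (⟨RingHom.ker (MvPolynomial.eval u), isPrime_ker_eval σ u⟩ :
        (Spec (CommRingCat.of (MvPolynomial σ k)) : Scheme.{u})) with hT
  have hvan : PrimeSpectrum.vanishingIdeal T = ⊥ := by
    refine le_bot_iff.1 fun f hf => ?_
    rw [PrimeSpectrum.mem_vanishingIdeal] at hf
    have hzero : ∀ u : σ → k, MvPolynomial.eval u f = 0 := fun u =>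
      (RingHom.mem_ker).1 (hf _ ⟨u, rfl⟩)
    exact (Submodule.mem_bot _).2 (MvPolynomial.funext fun u => by rw [hzero u, map_zero])
  change Dense (T : Set (PrimeSpectrum (MvPolynomial σ k)))
  rw [dense_iff_closure_eq, ← PrimeSpectrum.zeroLocus_vanishingIdeal_eq_closure, hvan]
  exact PrimeSpectrum.zeroLocus_bot

/-! ## Every `k`-morphism `𝔸^σ_k → A` is constant -/

section AffineSpace

variable (σ : Type)

/-- The line through the origin and the rational point `u`: `k[x_σ] → k[y]`, `x_i ↦ u_i · y`.
[cite: Milne1986AbelianVarieties, §3 Cor. 3.8] -/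
theorem aeval_one_comp_lineThrough (u : σ → k) :
    (MvPolynomial.aeval (fun _ : Fin 1 => (1 : k))).comp
        (MvPolynomial.aeval (fun i : σ => MvPolynomial.C (u i) * MvPolynomial.X (0 : Fin 1)) :
          MvPolynomial σ k →ₐ[k] R₁ k) =
      MvPolynomial.aeval u := by
  refine MvPolynomial.algHom_ext fun i => ?_
  simp only [AlgHom.comp_apply, MvPolynomial.aeval_X, map_mul, MvPolynomial.aeval_C, mul_one]
  rfl

/-- The line through the origin and `u` passes through the origin at `y = 0`.
[cite: Milne1986AbelianVarieties, §3 Cor. 3.8] -/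
theorem aeval_zero_comp_lineThrough (u : σ → k) :
    (MvPolynomial.aeval (fun _ : Fin 1 => (0 : k))).comp
        (MvPolynomial.aeval (fun i : σ => MvPolynomial.C (u i) * MvPolynomial.X (0 : Fin 1)) :
          MvPolynomial σ k →ₐ[k] R₁ k) =
      MvPolynomial.aeval (fun _ : σ => (0 : k)) := by
  refine MvPolynomial.algHom_ext fun i => ?_
  simp only [AlgHom.comp_apply, MvPolynomial.aeval_X, map_mul, MvPolynomial.aeval_C, mul_zero]

variable {σ}

/-- `Spec` of a `k`-algebra map `R → k` followed by `Spec` of the structure map is the identity of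
`Spec k`. [cite: Hartshorne1977, II Ex. 2.7] -/
theorem specMap_algHom_comp_specMap_algebraMap {R : Type u} [CommRing R] [Algebra k R]
    (ψ : R →ₐ[k] k) :
    Spec.map (CommRingCat.ofHom ψ.toRingHom) ≫ Spec.map (CommRingCat.ofHom (algebraMap k R)) = 𝟙 _ := by
  rw [specMap_ofHom_comp_specMap_ofHom, ψ.toRingHom_eq_coe, ψ.comp_algebraMap, Algebra.algebraMap_self,
    CommRingCat.ofHom_id, Spec.map_id]

/-- **A `k`-morphism `H : 𝔸^σ_k → A` takes the same value at every rational point as at the origin**: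
`H ∘ u = H ∘ 0` as `k`-points of `A`.  Restrict `H` to the line `y ↦ u·y` through `0` and `u`: a
`k`-morphism `𝔸¹_k → A`, constant by Milne Cor. 3.8 (the tree's
`AbelianVariety.specMap_affineLine_const`). [cite: Milne1986AbelianVarieties, §3 Cor. 3.8] -/
theorem AbelianVariety.specMap_aeval_comp_eq_origin (A : AbelianVariety k)
    (H : Spec (.of (MvPolynomial σ k)) ⟶ A.X.left)
    (hH : H ≫ A.X.hom = Spec.map (CommRingCat.ofHom (algebraMap k (MvPolynomial σ k)))) (u : σ → k) :
    Spec.map (CommRingCat.ofHom (MvPolynomial.aeval u : MvPolynomial σ k →ₐ[k] k).toRingHom) ≫ H =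
      Spec.map (CommRingCat.ofHom
        (MvPolynomial.aeval (fun _ : σ => (0 : k)) : MvPolynomial σ k →ₐ[k] k).toRingHom) ≫ H := by
  -- the line through `0` and `u`
  set ℓ : MvPolynomial σ k →ₐ[k] R₁ k := MvPolynomial.aeval (fun i : σ => MvPolynomial.C (u i) * MvPolynomial.X (0 : Fin 1))
    with hℓ
  set G : Spec (.of (R₁ k)) ⟶ A.X.left := Spec.map (CommRingCat.ofHom ℓ.toRingHom) ≫ H with hG
  have hGw : G ≫ A.X.hom = Spec.map (CommRingCat.ofHom (algebraMap k (R₁ k))) := by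
    rw [hG, Category.assoc, hH, specMap_ofHom_comp_specMap_ofHom, ℓ.toRingHom_eq_coe, ℓ.comp_algebraMap]
  obtain ⟨P, hP⟩ := A.specMap_affineLine_const G hGw
  -- evaluate at `y = 1` and `y = 0`
  have key : ∀ (ev : R₁ k →ₐ[k] k),
      Spec.map (CommRingCat.ofHom (ev.comp ℓ).toRingHom) ≫ H = P := fun ev => by
    have e1 : (ev.comp ℓ).toRingHom = ev.toRingHom.comp ℓ.toRingHom := rfl
    rw [e1, ← specMap_ofHom_comp_specMap_ofHom, Category.assoc, ← hG, hP, ← Category.assoc,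
      specMap_algHom_comp_specMap_algebraMap, Category.id_comp]
  have h1 := key (MvPolynomial.aeval (fun _ : Fin 1 => (1 : k)))
  have h0 := key (MvPolynomial.aeval (fun _ : Fin 1 => (0 : k)))
  rw [hℓ, aeval_one_comp_lineThrough σ u] at h1
  rw [hℓ, aeval_zero_comp_lineThrough σ u] at h0
  rw [h1, h0]

/-- **Every `k`-morphism `𝔸^σ_k → A` from an affine space (any set of variables `σ`, `k` infinite)
to an abelian variety is constant**: it factors through a `k`-point `P₀ : Spec k → A` of `A`
(namely its value at the origin).  Proof: by `specMap_aeval_comp_eq_origin` the morphism and the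
constant morphism agree at every rational point; rational points are dense
(`dense_range_rationalPoint_mvPolynomial`) and `A` is separated over `k`, so the two morphisms are
equal (`ext_of_dense_of_forall_exists_comp_eq`, Hartshorne II Ex. 4.2).
[cite: Milne1986AbelianVarieties, §3 Cor. 3.8] -/
theorem AbelianVariety.specMap_affineSpace_const [Infinite k] (A : AbelianVariety k)
    (H : Spec (.of (MvPolynomial σ k)) ⟶ A.X.left)
    (hH : H ≫ A.X.hom = Spec.map (CommRingCat.ofHom (algebraMap k (MvPolynomial σ k)))) :
    ∃ P₀ : Spec (.of k) ⟶ A.X.left, P₀ ≫ A.X.hom = 𝟙 _ ∧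
      H = Spec.map (CommRingCat.ofHom (algebraMap k (MvPolynomial σ k))) ≫ P₀ := by
  set P₀ : Spec (.of k) ⟶ A.X.left := Spec.map (CommRingCat.ofHom
      (MvPolynomial.aeval (fun _ : σ => (0 : k)) : MvPolynomial σ k →ₐ[k] k).toRingHom) ≫ H with hP₀
  have hP₀w : P₀ ≫ A.X.hom = 𝟙 _ := by
    rw [hP₀, Category.assoc, hH, specMap_algHom_comp_specMap_algebraMap]
  refine ⟨P₀, hP₀w, ?_⟩
  haveI : IsReduced (Spec (CommRingCat.of (MvPolynomial σ k)) : Scheme.{u}) :=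
    inferInstanceAs (IsReduced (Spec (.of (MvPolynomial σ k))))
  refine ext_of_dense_of_forall_exists_comp_eq H
    (Spec.map (CommRingCat.ofHom (algebraMap k (MvPolynomial σ k))) ≫ P₀) A.X.hom
    (by rw [hH, Category.assoc, hP₀w, Category.comp_id]) _ (dense_range_rationalPoint_mvPolynomial σ) ?_
  rintro _ ⟨u, rfl⟩
  refine ⟨_, Spec.map (CommRingCat.ofHom (MvPolynomial.aeval u : MvPolynomial σ k →ₐ[k] k).toRingHom),
    mem_range_specMap_aeval σ u, ?_⟩
  rw [A.specMap_aeval_comp_eq_origin H hH u, ← hP₀, ← Category.assoc,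
    specMap_algHom_comp_specMap_algebraMap, Category.id_comp]

end AffineSpace

/-! ## The generic point of `𝔸ⁿ_k`: `A(k(x₁, …, xₙ)) = A(k)` -/

/-- **A rational map `𝔸ⁿ ⇢ A` is constant**: a `k`-morphism from the generic point
`Spec k(x₁, …, xₙ) → A` of affine `n`-space (`k` infinite) to an abelian variety factors through a
`k`-point of `A`.  Spread it out to an open `U ∋ ξ` (Mathlib `spread_out_of_isGermInjective'`, Stacks
0BX6), extend to `𝔸ⁿ → A` (Milne Thm. 3.1, the tree's `AbelianVariety.exists_extension_specMap`) and
use `specMap_affineSpace_const` (Milne Cor. 3.8 in `n` variables).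
[cite: Milne1986AbelianVarieties, §3 Thm. 3.1 and Cor. 3.8] -/
theorem AbelianVariety.fromSpecStalk_genericPoint_affineSpace_const [Infinite k] (A : AbelianVariety k)
    (n : ℕ) (φ : Spec ((Spec (.of (MvPolynomial (Fin n) k))).presheaf.stalk (genericPoint (Spec (.of (MvPolynomial (Fin n) k))))) ⟶ A.X.left)
    (hφ : φ ≫ A.X.hom = (Spec (.of (MvPolynomial (Fin n) k))).fromSpecStalk _ ≫
      Spec.map (CommRingCat.ofHom (algebraMap k (MvPolynomial (Fin n) k)))) :
    ∃ P₀ : Spec (.of k) ⟶ A.X.left, P₀ ≫ A.X.hom = 𝟙 _ ∧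
      φ = ((Spec (.of (MvPolynomial (Fin n) k))).fromSpecStalk _ ≫
        Spec.map (CommRingCat.ofHom (algebraMap k (MvPolynomial (Fin n) k)))) ≫ P₀ := by
  obtain ⟨U, hxU, f, hφf, hf⟩ := spread_out_of_isGermInjective'
    (Spec.map (CommRingCat.ofHom (algebraMap k (MvPolynomial (Fin n) k)))) A.X.hom φ hφ
  haveI : Nonempty (U : Scheme.{u}) := ⟨⟨_, hxU⟩⟩
  haveI := smooth_specOver_mvPolynomial (k := k) n
  haveI := geometricallyIntegral_specOver_mvPolynomial (k := k) n
  obtain ⟨H, hH, hjH⟩ := A.exists_extension_specMap (R := MvPolynomial (Fin n) k) U.ι f hf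
  obtain ⟨P₀, hP₀w, hP₀⟩ := A.specMap_affineSpace_const H hH
  refine ⟨P₀, hP₀w, ?_⟩
  rw [hφf, ← hjH, hP₀, ← Category.assoc, ← Category.assoc, Scheme.Opens.fromSpecStalkOfMem_ι]

/-- `Spec` of a composite of `k`-algebra maps, in the currency `AlgPoints.specOverMapOfAlgHom`
(bookkeeping). [cite: Hartshorne1977, II Prop. 2.3] -/
theorem specOverMapOfAlgHom_comp_specOverMapOfAlgHom {R R' R'' : Type u} [CommRing R] [Algebra k R]
    [CommRing R'] [Algebra k R'] [CommRing R''] [Algebra k R''] (ψ₁ : R →ₐ[k] R') (ψ₂ : R' →ₐ[k] R'') :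
    AlgPoints.specOverMapOfAlgHom ψ₂ ≫ AlgPoints.specOverMapOfAlgHom ψ₁ =
      AlgPoints.specOverMapOfAlgHom (ψ₂.comp ψ₁) := by
  apply Over.OverMorphism.ext
  rw [Over.comp_left, AlgPoints.specOverMapOfAlgHom_left, AlgPoints.specOverMapOfAlgHom_left,
    AlgPoints.specOverMapOfAlgHom_left]
  exact (Spec.map_comp (CommRingCat.ofHom ψ₁.toRingHom) (CommRingCat.ofHom ψ₂.toRingHom)).symm

/-- `AlgPoints.specOverMapOfAlgHom` of the identity is the identity (bookkeeping).
[cite: Hartshorne1977, II Prop. 2.3] -/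
theorem specOverMapOfAlgHom_id' {R : Type u} [CommRing R] [Algebra k R] :
    AlgPoints.specOverMapOfAlgHom (AlgHom.id k R) = 𝟙 _ := by
  apply Over.OverMorphism.ext
  rw [AlgPoints.specOverMapOfAlgHom_left, Over.id_left]
  exact Spec.map_id _

/-- **`A(K) = A(k)` for a rational function field `K = Frac k[x₁, …, xₙ]`** (`k` infinite): every
`K`-valued point of an abelian variety `A / k` over a field of fractions `K` of `k[x₁, …, xₙ]` is the
constant point at a `k`-point of `A` (transport of the generic-point statement along `K ≅ K(𝔸ⁿ)`,
Mathlib `IsLocalization.algEquiv`, `functionField_isFractionRing_of_affine`).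
[cite: Milne1986AbelianVarieties, §3 Thm. 3.1 and Cor. 3.8] -/
theorem AbelianVariety.algPoints_const_of_isFractionRing_mvPolynomial [Infinite k] (A : AbelianVariety k)
    (n : ℕ) (K : Type u) [Field K] [Algebra k K] [Algebra (MvPolynomial (Fin n) k) K]
    [IsScalarTower k (MvPolynomial (Fin n) k) K] [IsFractionRing (MvPolynomial (Fin n) k) K]
    (x : AlgPoints A.X K) :
    ∃ P₀ : AlgPoints A.X k, x = AlgPoints.specOverMapOfAlgHom (Algebra.ofId k K) ≫ P₀ := by
  let Rn : Type u := MvPolynomial (Fin n) k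
  let F : Type u := ((Spec (.of (MvPolynomial (Fin n) k))).functionField : Type u)
  letI algF : Algebra Rn F := AlgebraicGeometry.instAlgebraCarrierFunctionFieldSpec (.of Rn)
  haveI : IsFractionRing Rn F :=
    AlgebraicGeometry.functionField_isFractionRing_of_affine (.of Rn)
  letI algkF : Algebra k F := ((algebraMap Rn F).comp (algebraMap k Rn)).toAlgebra
  haveI : IsScalarTower k Rn F := IsScalarTower.of_algebraMap_eq fun c => rfl
  have hfs : (Spec (.of (MvPolynomial (Fin n) k))).fromSpecStalk (genericPoint (Spec (.of (MvPolynomial (Fin n) k)))) =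
      Spec.map (CommRingCat.ofHom (algebraMap Rn F)) := by
    rw [Spec.fromSpecStalk_eq']; rfl
  -- `K ≅ K(𝔸ⁿ)` over `k[x]`, hence over `k`
  let e : K ≃ₐ[Rn] F := IsLocalization.algEquiv (nonZeroDivisors Rn) K F
  let eK : K →ₐ[k] F := (e : K →ₐ[Rn] F).restrictScalars k
  let eK' : F →ₐ[k] K := (e.symm : F →ₐ[Rn] K).restrictScalars k
  -- the given point, moved to the generic point of `𝔸ⁿ`
  set φ' : specOver k F ⟶ A.X := AlgPoints.specOverMapOfAlgHom eK ≫ x with hφ'def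
  have hφ : φ'.left ≫ A.X.hom = (Spec (.of (MvPolynomial (Fin n) k))).fromSpecStalk _ ≫
      Spec.map (CommRingCat.ofHom (algebraMap k Rn)) := by
    rw [Over.w φ', hfs, ← Spec.map_comp, ← CommRingCat.ofHom_comp]
    rfl
  obtain ⟨P₀, hP₀w, hP₀⟩ := A.fromSpecStalk_genericPoint_affineSpace_const n φ'.left hφ
  have hP₀w' : P₀ ≫ A.X.hom = (specOver k k).hom := by
    rw [hP₀w]
    change 𝟙 _ = Spec.map (CommRingCat.ofHom (algebraMap k k))
    rw [Algebra.algebraMap_self, CommRingCat.ofHom_id, Spec.map_id]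
  refine ⟨Over.homMk P₀ hP₀w', ?_⟩
  -- `x = Spec(e⁻¹) ≫ φ'`
  have h1 : x = AlgPoints.specOverMapOfAlgHom eK' ≫ φ' := by
    rw [hφ'def, ← Category.assoc, specOverMapOfAlgHom_comp_specOverMapOfAlgHom]
    have : eK'.comp eK = AlgHom.id k K := by
      ext y; exact e.symm_apply_apply y
    rw [this, specOverMapOfAlgHom_id', Category.id_comp]
  -- `φ'` is the constant point `P₀`
  have hφ'eq : φ' = AlgPoints.specOverMapOfAlgHom (Algebra.ofId k F) ≫ Over.homMk P₀ hP₀w' := by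
    apply Over.OverMorphism.ext
    rw [hP₀, hfs]
    change (Spec.map (CommRingCat.ofHom (algebraMap Rn F)) ≫
        Spec.map (CommRingCat.ofHom (algebraMap k Rn))) ≫ P₀ =
      Spec.map (CommRingCat.ofHom (algebraMap k F)) ≫ P₀
    rw [← Spec.map_comp, ← CommRingCat.ofHom_comp]
  have hψ : eK'.comp (Algebra.ofId k F) = Algebra.ofId k K := Subsingleton.elim _ _
  rw [h1, hφ'eq, ← Category.assoc, specOverMapOfAlgHom_comp_specOverMapOfAlgHom, hψ]

/-- **`A(K) = A(k)` along an identification `K ≅ Frac k[x₁, …, xₙ]`** over `k` (`k` infinite) —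
the form fed by Mathlib's `AlgebraicIndependent.aevalEquivField` for `K = k(r₁, …, rₙ)`,
`r` algebraically independent. [cite: Milne1986AbelianVarieties, §3 Cor. 3.8] -/
theorem AbelianVariety.algPoints_const_of_algEquiv_mvPolynomial [Infinite k] (A : AbelianVariety k)
    (n : ℕ) {K : Type u} [Field K] [Algebra k K]
    (e : FractionRing (MvPolynomial (Fin n) k) ≃ₐ[k] K) (x : AlgPoints A.X K) :
    ∃ P₀ : AlgPoints A.X k, x = AlgPoints.specOverMapOfAlgHom (Algebra.ofId k K) ≫ P₀ := by
  set x' : AlgPoints A.X (FractionRing (MvPolynomial (Fin n) k)) :=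
    AlgPoints.specOverMapOfAlgHom (e.symm : K →ₐ[k] FractionRing (MvPolynomial (Fin n) k)) ≫ x
    with hx'
  obtain ⟨P₀, hP₀⟩ :=
    A.algPoints_const_of_isFractionRing_mvPolynomial n (FractionRing (MvPolynomial (Fin n) k)) x'
  refine ⟨P₀, ?_⟩
  have h1 : x = AlgPoints.specOverMapOfAlgHom (e : FractionRing (MvPolynomial (Fin n) k) →ₐ[k] K) ≫ x' := by
    rw [hx', ← Category.assoc, specOverMapOfAlgHom_comp_specOverMapOfAlgHom]
    have : (e : FractionRing (MvPolynomial (Fin n) k) →ₐ[k] K).comp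
        (e.symm : K →ₐ[k] FractionRing (MvPolynomial (Fin n) k)) = AlgHom.id k K := by
      ext y; exact e.apply_symm_apply y
    rw [this, specOverMapOfAlgHom_id', Category.id_comp]
  have hψ : (e : FractionRing (MvPolynomial (Fin n) k) →ₐ[k] K).comp
      (Algebra.ofId k (FractionRing (MvPolynomial (Fin n) k))) = Algebra.ofId k K :=
    Subsingleton.elim _ _
  rw [h1, hP₀, ← Category.assoc, specOverMapOfAlgHom_comp_specOverMapOfAlgHom, hψ]

end Literature.AlgebraicGeometry.Motives
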